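import Summits.BirchSwinnertonDyer.Rank1Residual.Additive.X4SharpThreeKimLatticePeriod
import Summits.BirchSwinnertonDyer.Rank1Residual.Additive.X4SharpThreeKimLatticeRankOne
import Summits.BirchSwinnertonDyer.Rank1Residual.Additive.X4KimLargeImageIntegralityDischarged
import Summits.BirchSwinnertonDyer.Rank1Residual.Additive.X4KimLargeImageLevelKRankOneIrr
import HarnessLib

/-!
# The IMPLICATION LATTICE of the Kim-at-3 conjecture `Prop`s WITHOUT the integrality binder: the
# announced [K25] PRIMARY record (P1, `_OPEN`) alone sits on top of `KimThreeShaLength`, `KimThreeUnit`,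
# `X4SharpThreeKimShaLength`, `X4SharpThreeKimUnit`, p17's rank-one family — and on top of `KimThree` /
# `X4SharpThreeKim` modulo the period transfer ONLY (team n1011, seat p03, OWNERS rows T-a2 / T-a2-REC;
# §(η) of cells/n1011/KIM-AT-3-ANATOMY.md, η.7 / η.12 / η.13; referee 1 RA3 (iii))

HONEST FRAMING (cell `b2b-bsdres`, run/shared/lean/b2b/bsd-rank1-residual/, verbatim in every
file): the goal of the cell is to DELETE the COMBINATION-SHAPED residual classes of the
Birch–Swinnerton-Dyer formula for ALL analytic-rank `≤ 1` elliptic curves over `ℚ` — "full BSD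
formula for every rank `≤ 1` curve in class `C`" assembled STRICTLY from published theorems — so
that the rank-`≤ 1` remainder becomes exactly the CONSTRUCTION-SHAPED classes, which are TYPED
(missing-input `Prop`s), NOT attempted. This is not "finishing BSD". Team n1011 is a RESEARCH ROUTE;
no claim beyond the stated classes; labels and RESIDUAL-MAP marks (N11, O7) UNCHANGED; nothing is
booked. Theorems only: no definition, no named fact, NO new `Prop`. EVERY theorem below is CONDITIONAL
on the ANNOUNCED C.-H. Kim (app. R. Pollack), arXiv:2505.09121v1 (2025, PREPRINT) Thm. 1.1 in its own
currency — the binder `hK25s : Kim2025.thm11_kimShaLength_of_integralPeriod_OPEN`, never a theorem of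
the tree; FLAG `Kim2025-preprint`.

## What this file proves

The §(η) lattice files (`X4SharpThreeKimLattice`, `…LatticeRankOne`, `…LatticePeriod`) put the PRIMARY
announced record on top of the rank-`0` and rank-`1` lattices at `3` MODULO the `Ω⁺_f`-INTEGRALITY of
the plus symbols of every admissible datum (`hint`, row T-R18b, flag `Kim2025-OmegaE-integrality`):
`kimThreeShaLength_of_kim2025_OPEN_of_integral`, `kimThree_of_kim2025_OPEN_of_integral_of_periodTransfer`,
`kimThreeRankOnePartial_of_kim2025_OPEN_of_integral`, … .  Every node of those lattices carries the
`3`-adic TOWER as an antecedent, and on tower rows the integrality is now p09's THEOREM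
(`forall_padicValRat_ratPlusSymbol_nonneg_of_towerSurj`, `Additive/PlusSymbolIntegrality.lean`; the
int-free per-pair bridges `kimShaLengthRankZeroAt_of_thm11_OPEN` / `kimShaLengthAt_of_thm11_OPEN` of
`X4KimLargeImageIntegralityDischarged.lean`).  Hence the `hint` binder DISAPPEARS from every edge:

* §1 per pair (any `p ≥ 3`): `kimRankZeroShaLengthAt_of_thm11_OPEN` (P1 ⟹ cc-typer-1's
  `KimRankZeroShaLengthAt W p`); the rank-one per-pair twin is p11's `kimRankOnePartialAt_of_thm11`
  (`X4KimLargeImageLevelKRankOneIrr.lean`, reused BY NAME, not restated);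
* §2 class level, rank `0`, `p = 3`: `kimThreeShaLength_of_thm11_OPEN` (P1 ⟹ KS), hence
  `kimThreeUnit_of_thm11_OPEN` (**P1 ⟹ `KimThreeUnit`, p03's conjecture OF RECORD p249151, with NO
  further binder** — the unit shape carries the period transfer itself), `x4SharpThreeKimShaLength_of_thm11_OPEN`,
  `x4SharpThreeKimUnit_of_thm11_OPEN`; and **`kimThree_of_thm11_OPEN_of_periodTransfer`** (P1 ∧ per ⟹
  `KimThree` — referee 1's RA3 (iii) edge with ONE binder left, the period transfer `per`, which is the
  cell's theorem `X4.periodTransfer_of_optimal` on optimal data), `x4SharpThreeKim_of_thm11_OPEN_of_periodTransfer`;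
* §3 class level, rank `1`: p11's `kimThreeRankOnePartial_of_thm11` / `x4SharpThreeKimRankOnePartial_of_thm11`
  (reused BY NAME) pushed through p17's bookkeeping: `kimThreeRankOne_of_thm11_OPEN`,
  `kimThreeRankOneLevelTwo_of_thm11_OPEN`.

§(η) node table update (η.13): the incoming `[K25]` edges of KS, KU, NS, NU (this file) and KP, NP (p11's
`X4KimLargeImageLevelKRankOneIrr.lean`), hence K1, K2, are now "O6 (PRE)" with NO binder; those of K0 / N0
are "O6 ∧ per".  Nothing is booked; no mark moves;
the conjectures stay conjectures — what is proved is their implication from the flagged preprint.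

References: [Kim2025RefinedTNC] Thm. 1.1, Cor. 1.7 (PREPRINT); [Kim2022StructureSelmer] Thm. 1.9 (1),
(4), (6), §1.3.5, §1.4.1, §1.4.3, §1.5.1; [Sakamoto2024KolyvaginThree] Thm. 1.1; Manin 1972 / Drinfeld
1973 as used in `PlusSymbolIntegrality.lean`; cell files cells/n1011/KIM-AT-3-ANATOMY.md §(η),
cells/n1011/REFEREE-1.md (ACK-1 T-a2, RA3 (iii)).
-/

noncomputable section

open scoped Classical MatrixGroups ModularForm

open CongruenceSubgroup WeierstrassCurve Literature.NumberTheory.EllipticCurves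
  Literature.NumberTheory.EllipticCurves.ModularForms
  Literature.NumberTheory.EllipticCurves.Rank1Residual
  Literature.NumberTheory.EllipticCurves.Rank1Residual.Typed

namespace Summit.BirchSwinnertonDyer.Rank1Residual.Additive

open Summit.BirchSwinnertonDyer.Rank1Residual.X4

/-! ## §1 Per pair, any `p ≥ 3`: the PRIMARY record without `hint` -/

section PerPair

variable (W : WeierstrassCurve ℚ) [W.IsElliptic] [W.IsGloballyMinimal] (p : ℕ) [Fact p.Prime]

/-- **P1 (OPEN) ⟹ `KimRankZeroShaLengthAt W p`** at `p ≥ 3`, NO integrality binder: the shape's own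
tower antecedent feeds p09's `kimShaLengthRankZeroAt_of_thm11_OPEN` (integrality discharged by
`forall_padicValRat_ratPlusSymbol_nonneg_of_towerSurj`). Int-free twin of
`kimRankZeroShaLengthAt_of_kim2025_OPEN_of_integral`. CONDITIONAL on the preprint.
[claim: Kim2025RefinedTNC, status: under-review]
[cite: Kim2025RefinedTNC, Thm. 1.1 ("BSD") (ANNOUNCED preprint — the reason, not a source of truth)]
[cite: Sakamoto2024KolyvaginThree, Thm. 1.1] -/
theorem kimRankZeroShaLengthAt_of_thm11_OPEN
    (hK25s : Kim2025.thm11_kimShaLength_of_integralPeriod_OPEN) (hp3 : 3 ≤ p) :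
    KimRankZeroShaLengthAt W p :=
  fun _ ht hL hfin _ _ D _ hper => kimShaLengthRankZeroAt_of_thm11_OPEN W p hK25s hp3 ht hL hfin D hper

end PerPair

/-! ## §2 Class level at `p = 3`, rank `0` -/

section ClassLevelRankZero

/-- **P1 (OPEN) ⟹ `KimThreeShaLength`** — the announced PRIMARY record ALONE on top of the whole
rank-`0` lattice at `3`; int-free twin of `kimThreeShaLength_of_kim2025_OPEN_of_integral`.
CONDITIONAL on the preprint. [claim: Kim2025RefinedTNC, status: under-review]
[cite: Kim2025RefinedTNC, Thm. 1.1 ("BSD"), Cor. 1.7 (ANNOUNCED preprint — the reason, not a source of truth)]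
[cite: Sakamoto2024KolyvaginThree, Thm. 1.1] -/
theorem kimThreeShaLength_of_thm11_OPEN (hK25s : Kim2025.thm11_kimShaLength_of_integralPeriod_OPEN) :
    KimThreeShaLength :=
  fun W _ _ => kimRankZeroShaLengthAt_of_thm11_OPEN W 3 hK25s le_rfl

/-- **P1 (OPEN) ⟹ `X4SharpThreeKimShaLength`** (the `∂`-exact N11 hypothesis), NO integrality binder.
CONDITIONAL on the preprint. [claim: Kim2025RefinedTNC, status: under-review]
[cite: Kim2025RefinedTNC, Thm. 1.1 ("BSD"), Cor. 1.7 (ANNOUNCED preprint — the reason, not a source of truth)] -/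
theorem x4SharpThreeKimShaLength_of_thm11_OPEN
    (hK25s : Kim2025.thm11_kimShaLength_of_integralPeriod_OPEN) : X4SharpThreeKimShaLength :=
  fun W _ _ _ => kimRankZeroShaLengthAt_of_thm11_OPEN W 3 hK25s le_rfl

/-- **P1 (OPEN) ⟹ `KimThreeUnit`** — p03's unit conjecture OF RECORD (`X4SharpThreeKimShape.lean`,
p249151: a unit Kurihara number ⟹ `ord₃(L(E,1)/Ω) = ord₃ #Ш(E/ℚ)(3)`) from the announced PRIMARY record
with NO further binder (neither integrality — p09's theorem — nor a period transfer — the unit shape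
carries it). CONDITIONAL on the preprint. [claim: Kim2025RefinedTNC, status: under-review]
[cite: Kim2025RefinedTNC, Thm. 1.1 ("BSD"), Cor. 1.7 (ANNOUNCED preprint — the reason, not a source of truth)]
[cite: Kim2022StructureSelmer, Thm. 1.9 (1) and (6), §1.2.5] -/
theorem kimThreeUnit_of_thm11_OPEN (hK25s : Kim2025.thm11_kimShaLength_of_integralPeriod_OPEN) :
    KimThreeUnit :=
  kimThreeUnit_of_kimThreeShaLength (kimThreeShaLength_of_thm11_OPEN hK25s)

/-- **P1 (OPEN) ⟹ `X4SharpThreeKimUnit`** (the N11 unit/EQUALITY hypothesis), NO further binder.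
CONDITIONAL on the preprint. [claim: Kim2025RefinedTNC, status: under-review]
[cite: Kim2025RefinedTNC, Thm. 1.1 ("BSD"), Cor. 1.7 (ANNOUNCED preprint — the reason, not a source of truth)] -/
theorem x4SharpThreeKimUnit_of_thm11_OPEN (hK25s : Kim2025.thm11_kimShaLength_of_integralPeriod_OPEN) :
    X4SharpThreeKimUnit :=
  x4SharpThreeKimUnit_of_x4SharpThreeKimShaLength (x4SharpThreeKimShaLength_of_thm11_OPEN hK25s)

/-- **P1 (OPEN) ∧ per ⟹ `KimThree`** — referee 1's RA3 (iii) edge onto p03's inequality conjecture OF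
RECORD with ONE binder left: the period transfer `per` (`Ω(W) = u·Ω⁺_{D.f}`, `‖u‖₃ = 1`, for every
admissible datum; the cell's theorem `X4.periodTransfer_of_optimal` on optimal data with `3 ∤ c_D`).
Int-free twin of `kimThree_of_kim2025_OPEN_of_integral_of_periodTransfer`. CONDITIONAL on the preprint.
[claim: Kim2025RefinedTNC, status: under-review]
[cite: Kim2025RefinedTNC, Thm. 1.1 ("BSD"), Cor. 1.7 (ANNOUNCED preprint — the reason, not a source of truth)]
[cite: Kim2022StructureSelmer, §1.3.5 and §1.5.1 (PDF p. 7)] -/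
theorem kimThree_of_thm11_OPEN_of_periodTransfer
    (hK25s : Kim2025.thm11_kimShaLength_of_integralPeriod_OPEN)
    (hper : ∀ (W : WeierstrassCurve ℚ) [W.IsElliptic] [W.IsGloballyMinimal]
      {N : ℕ} [NeZero N] (D : ModularParametrizationData W N), ¬ (3 : ℤ) ∣ D.maninConstant →
      ∃ u : ℚ, ‖(u : ℚ_[3])‖ = 1 ∧ W.realPeriodRat = u * plusPeriod D.f) :
    KimThree :=
  kimThree_of_kimThreeShaLength_of_periodTransfer (kimThreeShaLength_of_thm11_OPEN hK25s) hper

/-- **P1 (OPEN) ∧ per (additive rows) ⟹ `X4SharpThreeKim`** (the N11 hypothesis, inequality shape of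
record), NO integrality binder. CONDITIONAL on the preprint. [claim: Kim2025RefinedTNC, status: under-review]
[cite: Kim2025RefinedTNC, Thm. 1.1 ("BSD"), Cor. 1.7 (ANNOUNCED preprint — the reason, not a source of truth)] -/
theorem x4SharpThreeKim_of_thm11_OPEN_of_periodTransfer
    (hK25s : Kim2025.thm11_kimShaLength_of_integralPeriod_OPEN)
    (hper : ∀ (W : WeierstrassCurve ℚ) [W.IsElliptic] [W.IsGloballyMinimal], Addv W 3 →
      ∀ {N : ℕ} [NeZero N] (D : ModularParametrizationData W N), ¬ (3 : ℤ) ∣ D.maninConstant →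
      ∃ u : ℚ, ‖(u : ℚ_[3])‖ = 1 ∧ W.realPeriodRat = u * plusPeriod D.f) :
    X4SharpThreeKim :=
  x4SharpThreeKim_of_x4SharpThreeKimShaLength_of_periodTransfer
    (x4SharpThreeKimShaLength_of_thm11_OPEN hK25s) hper

end ClassLevelRankZero

/-! ## §3 Class level at `p = 3`, rank `1` (p17's family) -/

section ClassLevelRankOne

/-- **P1 (OPEN) ⟹ `KimThreeRankOne`** (p17's unit shape in rank one): p11's int-free
`kimThreeRankOnePartial_of_thm11` through `kimThreeRankOne_of_kimThreeRankOnePartial`. CONDITIONAL on the preprint.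
[claim: Kim2025RefinedTNC, status: under-review]
[cite: Kim2025RefinedTNC, Thm. 1.1 (Str)/("BSD") (ANNOUNCED preprint — the reason, not a source of truth)]
[cite: Kim2022StructureSelmer, Thm. 1.9 (1), (4), (6) (PDF pp. 7–8)] -/
theorem kimThreeRankOne_of_thm11_OPEN (hK25s : Kim2025.thm11_kimShaLength_of_integralPeriod_OPEN) :
    KimThreeRankOne :=
  kimThreeRankOne_of_kimThreeRankOnePartial (kimThreeRankOnePartial_of_thm11 hK25s)

/-- **P1 (OPEN) ⟹ `KimThreeRankOneLevelTwo`** (p17's level-two shape): p11's int-free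
`kimThreeRankOnePartial_of_thm11` through `kimThreeRankOneLevelTwo_of_kimThreeRankOnePartial`. CONDITIONAL on the preprint.
[claim: Kim2025RefinedTNC, status: under-review]
[cite: Kim2025RefinedTNC, Thm. 1.1 (Str)/("BSD") (ANNOUNCED preprint — the reason, not a source of truth)]
[cite: Kim2022StructureSelmer, Thm. 1.9 (6), §1.2.2 (PDF pp. 5–8)] -/
theorem kimThreeRankOneLevelTwo_of_thm11_OPEN
    (hK25s : Kim2025.thm11_kimShaLength_of_integralPeriod_OPEN) : KimThreeRankOneLevelTwo :=
  kimThreeRankOneLevelTwo_of_kimThreeRankOnePartial (kimThreeRankOnePartial_of_thm11 hK25s)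

end ClassLevelRankOne

end Summit.BirchSwinnertonDyer.Rank1Residual.Additive

end
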